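import Mathlib
import Literature.Computability.Complexity.Nondeterministic
import Literature.Computability.Complexity.DiagMachine
import Literature.Computability.Complexity.PaulPippengerSzemerediTrotter1983Clocks
import Literature.Computability.Complexity.TimeConstructibleClosure
import HarnessLib

/-!
# BC5 rung for `NtimeComplementLadder.ConlinNotInNlin` — the sub-diagonal complementation rung

`coNTIME(n²) ⊄ NTIME(n)`: a proved member of the crux's family `coNTIME(g) ⊄ NTIME(f)` (the crux is the
diagonal `g = f = n`). Folklore (Diehl–van Melkebeek–Williams 2011, Lemma 2: `a < b ⇒ coNTIME(n^b) ⊄ NTIME(n^a)`);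
here from Žák's nondeterministic time hierarchy (`Diag.ntime_hierarchy_holds`, proved in the tree) by the
swap trick: `coNTIME(n²) ⊆ NTIME(n)` would give `NTIME(n²) ⊆ coNTIME(n) ⊆ coNTIME(n²) ⊆ NTIME(n)`.
Intended landing: `Summits/PneNP/PneNP/Theorems/NtimeComplementLadderRung.lean` (supports the crux item).
-/

set_option linter.dupNamespace false

namespace Summit.PneNP.PneNP.Theorems.NtimeComplementLadderRung

open Filter Literature.Computability.Complexity

/-- `(n + 1) = o(n²)` over `ℝ`, in the shape `ntime_hierarchy` wants. -/
theorem isLittleO_succ_sq :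
    (fun n => ((n + 1 : ℕ) : ℝ)) =o[atTop] fun n => (((fun m : ℕ => m ^ 2) n : ℕ) : ℝ) := by
  refine Asymptotics.isLittleO_iff.2 fun ε hε => ?_
  obtain ⟨K, hK⟩ := exists_nat_gt (2 / ε)
  filter_upwards [eventually_ge_atTop K, eventually_ge_atTop 1] with n hn hn1
  rw [Real.norm_natCast, Real.norm_natCast, Nat.cast_add, Nat.cast_one]
  have hK' : (2 : ℝ) / ε < n := lt_of_lt_of_le hK (by exact_mod_cast hn)
  have h2 : (2 : ℝ) < ε * n := by
    have := (div_lt_iff₀ hε).1 hK'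
    linarith [this]
  have hn1' : (1 : ℝ) ≤ n := by exact_mod_cast hn1
  have hnn : (0 : ℝ) ≤ n := by positivity
  have hsq : (((n ^ 2 : ℕ)) : ℝ) = (n : ℝ) * n := by push_cast; ring
  rw [hsq]
  nlinarith [h2, hn1', hnn, mul_nonneg hnn hε.le]

/-- **Rung (BC5 witness).** `coNTIME(n²) ⊄ NTIME(n)` for the tree's multi-stack verifier classes. -/
theorem coNTIME_sq_not_subset_NTIME_id :
    ¬ (coNTIME (fun n => n ^ 2) ⊆ NTIME (fun n => n)) := by
  intro h
  -- time constructibility of `n` and `n²`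
  have hid : IsTimeConstructible (fun n : ℕ => n) := isTimeConstructible_id
  have hsq : IsTimeConstructible (fun n : ℕ => n ^ 2) := isTimeConstructible_id.pow (by norm_num)
  -- `NTIME(n) ⊆ NTIME(n²)` hence `coNTIME(n) ⊆ coNTIME(n²)`
  have hmono : NTIME (fun n : ℕ => n) ⊆ NTIME (fun n : ℕ => n ^ 2) :=
    NTIME_mono_holds hid (fun n => by simpa [sq] using Nat.le_mul_self n)
  have hcomono : coNTIME (fun n : ℕ => n) ⊆ coNTIME (fun n : ℕ => n ^ 2) := co_mono hmono
  -- swap trick: `NTIME(n²) ⊆ NTIME(n)`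
  have hsub : NTIME (fun n : ℕ => n ^ 2) ⊆ NTIME (fun n : ℕ => n) := by
    intro L hL
    have h1 : Lᶜ ∈ coNTIME (fun n : ℕ => n ^ 2) := by
      show Lᶜ ∈ co (NTIME (fun n : ℕ => n ^ 2))
      simpa [co] using hL
    have h2 : Lᶜ ∈ NTIME (fun n : ℕ => n) := h h1
    have h3 : L ∈ coNTIME (fun n : ℕ => n) := by
      show L ∈ co (NTIME (fun n : ℕ => n))
      simpa [co] using h2
    exact h (hcomono h3)
  exact Diag.ntime_hierarchy_holds (fun n => n) (fun n => n ^ 2) hid hsq isLittleO_succ_sq hsub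

end Summit.PneNP.PneNP.Theorems.NtimeComplementLadderRung
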